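import Summits.SmoothPoincare4.SmoothPoincare4.Theses.SymplecticCap
import Literature.Geometry.Symplectic.AlmostComplexStructure
import Literature.Geometry.Symplectic.JHolomorphicEnergyDensity
import Literature.Geometry.Symplectic.ExactNoJSpheres
import Literature.Geometry.Manifold.DeRhamFundamentalClassPairing
import Literature.Topology.FourManifolds.ComplexProjectiveSpaceCohomology
import Literature.Topology.FourManifolds.ComplexProjectiveSpaceProofs
import Literature.NumberTheory.Transcendental.FormIntegrationPositivity
import Summits.SmoothPoincare4.SmoothPoincare4.Theorems.SymplecticOrigamiGromovRecognitionRelEndNoJSpheresHomology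
import Summits.SmoothPoincare4.SmoothPoincare4.Theorems.SymplecticOrigamiGromovRecognitionRelEndNoJSpheresOrientation
import Summits.SmoothPoincare4.SmoothPoincare4.Theorems.SymplecticOrigamiGromovRecognitionRelEndNoJSpheresGlue
import Summits.SmoothPoincare4.SmoothPoincare4.Theorems.SymplecticOrigamiGromovRecognitionRelEndNoJSpheresGlueDeriv

/-!
# No `J`-spheres in a manifold with `π₂ = 0` tamed by a closed form
(registered helper `helper_noJSpheres` of line `cross-cap-laurent`, crux `GromovRecognitionRelEnd`,
item stmt-SmoothPoincare4-11009)

The ONE place where the hypothesis `π₂(M) = 0` of the crux enters the proof of the core stub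
`stub_biFoliationCore` (compactness of the two families of `JX`-spheres of the wedge cap: a bubble
missing the wedge lies in `ι(M)`, hence is a `J`-sphere of `M`, hence constant): **in a connected
smooth 4-manifold `M` with `π₂(M) = 0`, an almost complex structure `J` tamed by a CLOSED smooth
2-form `sf` admits no non-constant `J`-holomorphic sphere** (two-chart form `u, v : ℂ → M`,
`v z = u z⁻¹`). This is also the registered `stub_noJSpheres` of the sister line
`hopf-planes-no-cap` (with `M` connected).

Proof (McDuff–Salamon 2017, §4.5 (4.5.4) "`E(u) = ∫ u^*ω = ⟨[ω], [u]⟩`"; Wendl 2018, Rem. 9.14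
"`[ω]|_{π₂} = 0` prevents bubbling"): glue `(u, v)` to a smooth map `F : ℂℙ¹ → M` (the tree's
`ComplexProjectiveSpace 1`, whose two affine charts have transition `c ↦ 1/c`;
`helper_gluedSphereContMDiff`, `helper_gluedSphereMfderiv`); the pulled back form `β = F^* sf` on
`ℂℙ¹` is, in each affine chart, the planar energy density `sf(du·ζ, J du·ζ) ≥ 0` (tameness),
positive where `du ≠ 0`, which happens somewhere unless `u` is constant; so `∫ β > 0` for the
complex orientation (`helper_projectiveLineOrientation`, `MForm.integral_pos_of_sign_mul_apply_nonneg`),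
`β` is not exact (Stokes), `⟨e[sf], F_*[ℂℙ¹]⟩ = ⟨e[β], [ℂℙ¹]⟩ ≠ 0` (de Rham pairing, naturality);
but `π₂(M) = 0` makes `F` null-homotopic (`ℂℙ¹ ≅ S²`), so `F_* = 0` on `H₂`
(`helper_projectiveLineNullHomology`) — contradiction.
-/

noncomputable section

-- the prescribed namespace `Summit.<P>.<Sub>.…` duplicates `SmoothPoincare4` (P = Sub)
set_option linter.dupNamespace false

open scoped Manifold ContDiff Topology
open Set Function Module TopologicalSpace
open Literature.Geometry.Kaehler Literature.Geometry.Symplectic Literature.Geometry.Manifold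
open Literature.Topology.FourManifolds Literature.AlgebraicTopology.SingularHomology
open Literature.Topology.FourManifolds.ComplexProjectiveSpace
open Literature.AlgebraicTopology.Homotopy Literature.NumberTheory.Transcendental

namespace Summit.SmoothPoincare4.SmoothPoincare4.Theorems.GromovRecognitionRelEnd.CrossCapLaurent

namespace NoJSpheres

/-- **Planar alternating forms are multiples of the area form**: for a real-bilinear alternating
`B` on `ℂ`, `B(x, y) = B(1, i) · (x.re y.im - x.im y.re)`. [folklore] -/
theorem planar_apply_eq (B : ℂ [⋀^Fin 2]→ₗ[ℝ] ℝ) (x y : ℂ) :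
    B ![x, y] = B ![1, Complex.I] * (x.re * y.im - x.im * y.re) := by
  have h := AlternatingMap.eq_smul_basis_det Complex.basisOneI B
  conv_lhs => rw [h]
  rw [AlternatingMap.smul_apply, Complex.coe_basisOneI, smul_eq_mul, Module.Basis.det_apply,
    Matrix.det_fin_two]
  simp only [Module.Basis.toMatrix_apply, Complex.coe_basisOneI_repr, Matrix.cons_val_zero,
    Matrix.cons_val_one]
  ring

/-- `[1 : z]` (the point `mk (homogenize 0 (z))` of `ℂℙ¹`) lies in the chart `0`. [folklore] -/
theorem coordNeZero_zero_pt (z : ℂ) :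
    CoordNeZero 0 (ComplexProjectiveSpace.mk (homogenize 0 fun _ : Fin 1 => z)) := by
  simp [homogenize]

/-- Its `0`-th affine coordinate is `z`. [folklore] -/
theorem affineCoordComplex_zero_pt (z : ℂ) :
    affineCoordComplex 0 (ComplexProjectiveSpace.mk (homogenize 0 fun _ : Fin 1 => z)) 0 = z := by
  have e0 : (0 : Fin 2).succAbove (0 : Fin 1) = 1 := by decide
  simp [homogenize, e0]

/-- `[1 : z]` lies in the chart `1` only if `z ≠ 0`. [folklore] -/
theorem ne_zero_of_coordNeZero_one_pt {z : ℂ}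
    (h : CoordNeZero 1 (ComplexProjectiveSpace.mk (homogenize 0 fun _ : Fin 1 => z))) : z ≠ 0 := by
  have e0 : (0 : Fin 2).succAbove (0 : Fin 1) = 1 := by decide
  simp only [homogenize, coordNeZero_mk] at h
  rwa [show (1 : Fin 2) = Fin.succAbove 0 0 from e0.symm, Fin.insertNth_apply_succAbove] at h

/-- Its `1`-st affine coordinate is `z⁻¹`. [folklore] -/
theorem affineCoordComplex_one_pt (z : ℂ) :
    affineCoordComplex 1 (ComplexProjectiveSpace.mk (homogenize 0 fun _ : Fin 1 => z)) 0 = z⁻¹ := by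
  have e0 : (0 : Fin 2).succAbove (0 : Fin 1) = 1 := by decide
  have e1 : (1 : Fin 2).succAbove (0 : Fin 1) = 0 := by decide
  simp only [homogenize, affineCoordComplex_mk, e1, Fin.insertNth_apply_same]
  rw [show (1 : Fin 2) = Fin.succAbove 0 0 from e0.symm, Fin.insertNth_apply_succAbove, one_div]

section Manifold

variable {M : Type} [TopologicalSpace M] [ChartedSpace (EuclideanSpace ℝ (Fin 4)) M]

omit [TopologicalSpace M] [ChartedSpace (EuclideanSpace ℝ (Fin 4)) M] in
/-- **Gluing the two charts**: a pair `u, v : ℂ → M` with `v z = u z⁻¹` off `0` defines a map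
`F : ℂℙ¹ → M`, `[w₀ : w₁] ↦ u (w₁ / w₀)` on `{w₀ ≠ 0}` and `↦ v (w₀ / w₁)` on `{w₁ ≠ 0}`. [folklore] -/
theorem exists_glued (u v : ℂ → M) (huv : ∀ z : ℂ, z ≠ 0 → v z = u z⁻¹) :
    ∃ F : ComplexProjectiveSpace 1 → M,
      (∀ p, CoordNeZero 0 p → F p = u (affineCoordComplex 0 p 0)) ∧
      (∀ p, CoordNeZero 1 p → F p = v (affineCoordComplex 1 p 0)) := by
  classical
  refine ⟨fun p => if CoordNeZero 0 p then u (affineCoordComplex 0 p 0)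
    else v (affineCoordComplex 1 p 0), fun p hp => if_pos hp, fun p hp => ?_⟩
  dsimp only
  by_cases h0 : CoordNeZero 0 p
  · rw [if_pos h0]
    induction p using ComplexProjectiveSpace.ind with
    | h w =>
      simp only [coordNeZero_mk] at h0 hp
      simp only [affineCoordComplex_mk]
      have e0 : (0 : Fin 2).succAbove (0 : Fin 1) = 1 := by decide
      have e1 : (1 : Fin 2).succAbove (0 : Fin 1) = 0 := by decide
      rw [e0, e1, huv _ (div_ne_zero h0 hp), inv_div]
  · rw [if_neg h0]

/-- **Non-constant smooth maps have a non-zero differential somewhere** (contrapositive of the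
tree's `apply_eq_apply_zero_of_mfderiv_eq_zero`). [folklore] -/
theorem exists_mfderiv_ne_zero [IsManifold (𝓡 4) ∞ M] {u : ℂ → M} (hu : ContMDiff 𝓘(ℝ, ℂ) (𝓡 4) ∞ u)
    (hne : ∃ z, u z ≠ u 0) : ∃ z, mfderiv 𝓘(ℝ, ℂ) (𝓡 4) u z ≠ 0 := by
  by_contra h
  push Not at h
  obtain ⟨z, hz⟩ := hne
  exact hz (apply_eq_apply_zero_of_mfderiv_eq_zero (hu.of_le (by exact_mod_cast le_top)) h z)

/-- If `du_{z₀} ≠ 0` and `v = u ∘ (·)⁻¹` off `0`, then `dv_{z₀⁻¹} ≠ 0` (`z₀ ≠ 0`): `u = v ∘ (·)⁻¹`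
near `z₀`, chain rule. [folklore] -/
theorem mfderiv_inv_chart_ne_zero {u v : ℂ → M} (hv : ContMDiff 𝓘(ℝ, ℂ) (𝓡 4) ∞ v)
    (huv : ∀ z : ℂ, z ≠ 0 → v z = u z⁻¹) {z₀ : ℂ} (hz : z₀ ≠ 0)
    (hz₀ : mfderiv 𝓘(ℝ, ℂ) (𝓡 4) u z₀ ≠ 0) : mfderiv 𝓘(ℝ, ℂ) (𝓡 4) v z₀⁻¹ ≠ 0 := by
  intro h0
  apply hz₀
  -- `u = v ∘ (·)⁻¹` near `z₀`
  have hEq : u =ᶠ[𝓝 z₀] (v ∘ fun w : ℂ => w⁻¹) := by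
    filter_upwards [isOpen_ne.mem_nhds hz] with w hw
    change u w = v w⁻¹
    rw [huv w⁻¹ (inv_ne_zero hw), inv_inv]
  rw [hEq.mfderiv_eq]
  have hinv : MDifferentiableAt 𝓘(ℝ, ℂ) 𝓘(ℝ, ℂ) (fun w : ℂ => w⁻¹) z₀ :=
    ((differentiableAt_inv (𝕜 := ℂ) hz).restrictScalars ℝ).mdifferentiableAt
  have hvd : MDifferentiableAt 𝓘(ℝ, ℂ) (𝓡 4) v ((fun w : ℂ => w⁻¹) z₀) :=
    (hv _).mdifferentiableAt (by simp)
  rw [mfderiv_comp z₀ hvd hinv]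
  change (mfderiv 𝓘(ℝ, ℂ) (𝓡 4) v z₀⁻¹).comp _ = 0
  rw [h0, ContinuousLinearMap.zero_comp]

end Manifold

section Main

variable {M : Type} [TopologicalSpace M] [T2Space M] [SecondCountableTopology M]
  [ChartedSpace (EuclideanSpace ℝ (Fin 4)) M] [IsManifold (𝓡 4) ∞ M]

/-- **The main lemma of this file** — no `J`-spheres in a connected manifold with `π₂ = 0` tamed by a
closed form (McDuff–Salamon 2017, §4.5 (4.5.4); Wendl 2018, Rem. 9.14).
[cite: McDuffSalamon2017, §4.5 eq. (4.5.4)] -/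
theorem noJSpheres [ConnectedSpace M] (sf : MForm (𝓡 4) M ℝ 2)
    (J : AlmostComplexStructure (𝓡 4) ∞ M) (u v : ℂ → M)
    (hπ : ∀ x : M, Subsingleton (π_ 2 M x)) (hs : IsSmoothForm sf) (hc : IsClosedForm sf)
    (ht : J.IsTamedBy sf) (hu : ContMDiff 𝓘(ℝ, ℂ) (𝓡 4) ∞ u) (hv : ContMDiff 𝓘(ℝ, ℂ) (𝓡 4) ∞ v)
    (huv : ∀ z : ℂ, z ≠ 0 → v z = u z⁻¹) (hJu : IsJHolomorphic (𝓡 4) (fun y => J y) u)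
    (hJv : IsJHolomorphic (𝓡 4) (fun y => J y) v) : ∀ z : ℂ, u z = u 0 := by
  by_contra hne
  push Not at hne
  haveI : Fact (finrank ℝ (EuclideanSpace ℝ (Fin (2 * 1))) = 2 * 1) :=
    Fact.mk (@finrank_euclideanSpace_fin ℝ _ (2 * 1))
  haveI : LocallyCompactSpace M := ChartedSpace.locallyCompactSpace (EuclideanSpace ℝ (Fin 4)) M
  haveI : LocallyPathConnectedSpace M :=
    ChartedSpace.locallyPathConnectedSpace (EuclideanSpace ℝ (Fin 4)) M
  haveI : PathConnectedSpace M := pathConnectedSpace_iff_connectedSpace.2 ‹ConnectedSpace M›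
  -- (0) the complex coordinate `ℓ` of the model plane and its area form `A`
  set ℓ : EuclideanSpace ℝ (Fin (2 * 1)) →L[ℝ] ℂ :=
    (ContinuousLinearMap.proj (R := ℝ) (φ := fun _ : Fin 1 => ℂ) 0).comp
      ((realCoordinates 1).symm : EuclideanSpace ℝ (Fin (2 * 1)) →L[ℝ] (Fin 1 → ℂ)) with hℓdef
  have hℓ : ∀ a : EuclideanSpace ℝ (Fin (2 * 1)), ((realCoordinates 1).symm a) 0 = ℓ a :=
    fun a => rfl
  have hℓR : ∀ w : Fin 1 → ℂ, ℓ (realCoordinates 1 w) = w 0 := fun w => by simp [hℓdef]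
  set A : EuclideanSpace ℝ (Fin (2 * 1)) [⋀^Fin (2 * 1)]→ₗ[ℝ] ℝ :=
    (Complex.basisOneI.det).compLinearMap (ℓ : EuclideanSpace ℝ (Fin (2 * 1)) →L[ℝ] ℂ).toLinearMap
    with hAdef
  have hAab : ∀ a b : EuclideanSpace ℝ (Fin (2 * 1)),
      A ![a, b] = (ℓ a).re * (ℓ b).im - (ℓ a).im * (ℓ b).re := by
    intro a b
    simp only [hAdef, AlternatingMap.compLinearMap_apply]
    rw [Module.Basis.det_apply, Matrix.det_fin_two]
    simp [Module.Basis.toMatrix_apply, Matrix.cons_val_zero, Matrix.cons_val_one]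
    ring
  have hA0 : A ≠ 0 := by
    intro h
    have h1 := congrArg (fun f => f ![realCoordinates 1 ![1], realCoordinates 1 ![Complex.I]]) h
    simp only [hAab, hℓR, AlternatingMap.zero_apply] at h1
    norm_num [Matrix.cons_val_zero] at h1
  -- (1) a point where `du ≠ 0`
  obtain ⟨z₀, hz₀⟩ := exists_mfderiv_ne_zero hu hne
  -- (2) the glued sphere
  obtain ⟨F, hF0, hF1⟩ := exists_glued u v huv
  have hF : ContMDiff (𝓡 (2 * 1)) (𝓡 4) ∞ F := helper_gluedSphereContMDiff M u v F hu hv hF0 hF1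
  -- (3) the pulled back form
  set β : MForm (𝓡 (2 * 1)) (ComplexProjectiveSpace 1) ℝ (2 * 1) := sf.pullback (𝓡 (2 * 1)) F
    with hβdef
  have hsf : sf ∈ closedSmoothForms (𝓡 4) M ℝ 2 := ⟨hs, hc⟩
  have hβ : β ∈ closedSmoothForms (𝓡 (2 * 1)) (ComplexProjectiveSpace 1) ℝ (2 * 1) :=
    pullback_mem_closedSmoothForms hF hsf
  -- (4) pointwise: `β_p = k_p • A` with `k_p ≥ 0`, and `k_{p₀} > 0` somewhere
  have htame : ∀ (x : M) (e : TangentSpace (𝓡 4) x), 0 ≤ sf x ![e, (fun y => J y) x e] :=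
    fun x e => ht.nonneg x e
  have htame' : ∀ (x : M) (e : TangentSpace (𝓡 4) x), e ≠ 0 → 0 < sf x ![e, (fun y => J y) x e] :=
    fun x e he => ht.pos x he
  -- the chart formula for `β`: in the preferred chart `i = chartIndex p`, `β_p(a, b) = Bᵢ(ℓ a, ℓ b)`
  have hchart : ∀ p : ComplexProjectiveSpace 1, ∃ (w : ℂ → M) (c : ℂ),
      IsJHolomorphic (𝓡 4) (fun y => J y) w ∧
      (∀ a b : EuclideanSpace ℝ (Fin (2 * 1)), β p ![a, b] = (sf.pullback 𝓘(ℝ, ℂ) w) c ![ℓ a, ℓ b]) ∧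
      ((chartIndex p = 0 ∧ w = u ∧ c = affineCoordComplex 0 p 0) ∨
        (chartIndex p = 1 ∧ w = v ∧ c = affineCoordComplex 1 p 0)) := by
    intro p
    have hd := helper_gluedSphereMfderiv M u v F hu hv hF0 hF1 p
    rcases Fin.exists_fin_two.1 ⟨chartIndex p, rfl⟩ with h | h
    · refine ⟨u, affineCoordComplex 0 p 0, hJu, fun a b => ?_, Or.inl ⟨h, rfl, rfl⟩⟩
      have hp0 : CoordNeZero 0 p := by simpa [h] using coordNeZero_chartIndex p
      have hFp : F p = u (affineCoordComplex 0 p 0) := hF0 p hp0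
      simp only [hβdef, MForm.pullback_apply, hd.1 h, hℓ]
      rw [hFp]
      congr 1
      funext j
      fin_cases j <;> rfl
    · refine ⟨v, affineCoordComplex 1 p 0, hJv, fun a b => ?_, Or.inr ⟨h, rfl, rfl⟩⟩
      have hp1 : CoordNeZero 1 p := by simpa [h] using coordNeZero_chartIndex p
      have hFp : F p = v (affineCoordComplex 1 p 0) := hF1 p hp1
      simp only [hβdef, MForm.pullback_apply, hd.2 h, hℓ]
      rw [hFp]
      congr 1
      funext j
      fin_cases j <;> rfl
  have hkey : ∀ p : ComplexProjectiveSpace 1, ∃ k : ℝ, 0 ≤ k ∧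
      ∀ a b : EuclideanSpace ℝ (Fin (2 * 1)), β p ![a, b] = k * A ![a, b] := by
    intro p
    obtain ⟨w, c, hJw, hab, -⟩ := hchart p
    refine ⟨(sf.pullback 𝓘(ℝ, ℂ) w) c ![(1 : ℂ), Complex.I], ?_, fun a b => ?_⟩
    · simpa using hJw.pullback_apply_pair_nonneg htame c 1
    · rw [hab, hAab]
      exact planar_apply_eq ((sf.pullback 𝓘(ℝ, ℂ) w) c).toAlternatingMap (ℓ a) (ℓ b)
  have hpos : ∃ p : ComplexProjectiveSpace 1, ∃ k : ℝ, 0 < k ∧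
      ∀ a b : EuclideanSpace ℝ (Fin (2 * 1)), β p ![a, b] = k * A ![a, b] := by
    refine ⟨ComplexProjectiveSpace.mk (homogenize 0 fun _ : Fin 1 => z₀), ?_⟩
    obtain ⟨w, c, hJw, hab, hcase⟩ :=
      hchart (ComplexProjectiveSpace.mk (homogenize 0 fun _ : Fin 1 => z₀))
    refine ⟨(sf.pullback 𝓘(ℝ, ℂ) w) c ![(1 : ℂ), Complex.I], ?_, fun a b => ?_⟩
    · have hdw : mfderiv 𝓘(ℝ, ℂ) (𝓡 4) w c ≠ 0 := by
        rcases hcase with ⟨-, rfl, rfl⟩ | ⟨h1, rfl, rfl⟩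
        · rwa [affineCoordComplex_zero_pt]
        · rw [affineCoordComplex_one_pt]
          have hp1 : CoordNeZero 1 (ComplexProjectiveSpace.mk (homogenize 0 fun _ : Fin 1 => z₀)) := by
            simpa [h1] using
              coordNeZero_chartIndex (ComplexProjectiveSpace.mk (homogenize 0 fun _ : Fin 1 => z₀))
          exact mfderiv_inv_chart_ne_zero hv huv (ne_zero_of_coordNeZero_one_pt hp1) hz₀
      simpa using hJw.pullback_apply_pair_pos htame' hdw one_ne_zero
    · rw [hab, hAab]
      exact planar_apply_eq ((sf.pullback 𝓘(ℝ, ℂ) w) c).toAlternatingMap (ℓ a) (ℓ b)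
  -- (5) the complex orientation (the ray of `A`) and the sign conditions
  set o : (p : ComplexProjectiveSpace 1) →
      Orientation ℝ (TangentSpace (𝓡 (2 * 1)) p) (Fin (2 * 1)) := fun _ => rayOfNeZero ℝ A hA0
    with hodef
  have ho : IsContinuousOrientation o := helper_projectiveLineOrientation (rayOfNeZero ℝ A hA0)
  set e := modelBasis (EuclideanSpace ℝ (Fin (2 * 1))) (2 * 1) with hedef
  have hsign : ∀ p : ComplexProjectiveSpace 1,
      Real.sign (orientationForm o p ⇑e) = Real.sign (A ⇑e) := fun p =>
    sign_someVector_rayOfNeZero A hA0 ⇑e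
  have hAe : A ⇑e ≠ 0 := fun h => hA0 ((AlternatingMap.map_basis_eq_zero_iff e A).1 h)
  have he01 : (⇑e : Fin (2 * 1) → EuclideanSpace ℝ (Fin (2 * 1))) = ![e 0, e 1] := by
    funext i; fin_cases i <;> rfl
  have h0 : ∀ p : ComplexProjectiveSpace 1, 0 ≤ Real.sign (orientationForm o p ⇑e) *
      (show EuclideanSpace ℝ (Fin (2 * 1)) [⋀^Fin (2 * 1)]→L[ℝ] ℝ from β p) ⇑e := by
    intro p
    obtain ⟨k, hk, hkab⟩ := hkey p
    rw [hsign p, he01]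
    change 0 ≤ Real.sign (A ![e 0, e 1]) * β p ![e 0, e 1]
    rw [hkab, mul_left_comm, real_sign_mul_self]
    positivity
  have h1 : ∃ p : ComplexProjectiveSpace 1, 0 < Real.sign (orientationForm o p ⇑e) *
      (show EuclideanSpace ℝ (Fin (2 * 1)) [⋀^Fin (2 * 1)]→L[ℝ] ℝ from β p) ⇑e := by
    obtain ⟨p, k, hk, hkab⟩ := hpos
    refine ⟨p, ?_⟩
    rw [hsign p, he01]
    change 0 < Real.sign (A ![e 0, e 1]) * β p ![e 0, e 1]
    rw [hkab, mul_left_comm, real_sign_mul_self]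
    rw [he01] at hAe
    positivity
  -- (6) `∫ β > 0`, so `β` is not exact and `[β] ≠ 0`, so `⟨e_P [β], [P] ⊗ 1⟩ ≠ 0`
  have hint : 0 < β.integral o := MForm.integral_pos_of_sign_mul_apply_nonneg ho hβ.1 h0 h1
  have hnex : β ∉ exactSmoothForms (𝓡 (2 * 1)) (ComplexProjectiveSpace 1) ℝ (2 * 1) := fun hex =>
    hint.ne' (MForm.integral_eq_zero_of_mem_exactSmoothForms_holds o ho hex)
  have hmk : deRhamCohomology.mk ⟨β, hβ⟩ ≠ 0 := fun h0' =>
    hnex (mem_exactSmoothForms_of_mk_eq_zero _ h0')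
  set μP := ComplexProjectiveSpace.homologicalOrientationInt 1 with hμP
  have heP : integrationDeRhamIsoFamily (EuclideanSpace ℝ (Fin (2 * 1))) (ComplexProjectiveSpace 1)
      (2 * 1) (deRhamCohomology.mk ⟨β, hβ⟩) ≠ 0 :=
    fun h0' => hmk ((LinearEquiv.map_eq_zero_iff _).1 h0')
  have hpairP : kroneckerPairing ℝ ℝ (ComplexProjectiveSpace 1) (2 * 1)
      (integrationDeRhamIsoFamily (EuclideanSpace ℝ (Fin (2 * 1))) (ComplexProjectiveSpace 1) (2 * 1)
        (deRhamCohomology.mk ⟨β, hβ⟩))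
      (singularHomology.coeffChange (ComplexProjectiveSpace 1) (algebraMap ℤ ℝ : ℤ →+* ℝ).toAddMonoidHom
        (2 * 1) μP.fundamentalClass) ≠ 0 :=
    fun h0' => heP (eq_zero_of_kroneckerPairing_coeffChange_fundamentalClass_eq_zero ℝ μP h0')
  -- (7) naturality: this is `⟨e_M [sf], F_* ([P] ⊗ 1)⟩`, which vanishes since `F_* = 0`
  have hnat : kroneckerPairing ℝ ℝ (ComplexProjectiveSpace 1) (2 * 1)
      (integrationDeRhamIsoFamily (EuclideanSpace ℝ (Fin (2 * 1))) (ComplexProjectiveSpace 1) (2 * 1)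
        (deRhamCohomology.mk ⟨β, hβ⟩))
      (singularHomology.coeffChange (ComplexProjectiveSpace 1) (algebraMap ℤ ℝ : ℤ →+* ℝ).toAddMonoidHom
        (2 * 1) μP.fundamentalClass) =
      kroneckerPairing ℝ ℝ M (2 * 1)
        (integrationDeRhamIsoFamily (EuclideanSpace ℝ (Fin 4)) M (2 * 1) (deRhamCohomology.mk ⟨sf, hsf⟩))
        (singularHomology.map ℝ ℝ ⟨F, hF.continuous⟩ (2 * 1)
          (singularHomology.coeffChange (ComplexProjectiveSpace 1)
            (algebraMap ℤ ℝ : ℤ →+* ℝ).toAddMonoidHom (2 * 1) μP.fundamentalClass)) := by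
    rw [← kroneckerPairing_map, ← integrationDeRhamIsoFamily_map_of_contMDiff hF (2 * 1),
      deRhamCohomology.map_mk]
  have hzero : singularHomology.map ℝ ℝ (⟨F, hF.continuous⟩ : C(ComplexProjectiveSpace 1, M)) (2 * 1) = 0 :=
    helper_projectiveLineNullHomology M ⟨F, hF.continuous⟩ hπ
  rw [hnat, hzero] at hpairP
  exact hpairP (by simp)

end Main

end NoJSpheres

/-- **Registered helper `helper_noJSpheres` (line cross-cap-laurent, crux stmt-SmoothPoincare4-11009;
also the sister line hopf-planes-no-cap's `stub_noJSpheres` with `M` connected).** In a connected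
smooth 4-manifold `M` with `π₂(M) = 0`, for an almost complex structure `J` tamed by a closed smooth
2-form `sf`, every `J`-holomorphic sphere in two-chart form (`u, v : ℂ → M` smooth and
`J`-holomorphic, `v z = u z⁻¹` for `z ≠ 0`) is constant. This is where `π₂(M) = 0` enters the proof
of the core `stub_biFoliationCore` (a `JX`-bubble of the cap missing the wedge lies in `ι(M)`).
[cite: McDuffSalamon2017, §4.5 eq. (4.5.4)] -/
theorem helper_noJSpheres : ∀ (M : Type) [TopologicalSpace M] [T2Space M] [SecondCountableTopology M] [ChartedSpace (EuclideanSpace ℝ (Fin 4)) M] [IsManifold (𝓡 4) ∞ M] [ConnectedSpace M] (sf : Literature.Geometry.Kaehler.MForm (𝓡 4) M ℝ 2) (J : Literature.Geometry.Symplectic.AlmostComplexStructure (𝓡 4) ∞ M) (u v : ℂ → M), (∀ x : M, Subsingleton (π_ 2 M x)) → Literature.Geometry.Kaehler.IsSmoothForm sf → Literature.Geometry.Kaehler.IsClosedForm sf → J.IsTamedBy sf → ContMDiff 𝓘(ℝ, ℂ) (𝓡 4) ∞ u → ContMDiff 𝓘(ℝ, ℂ) (𝓡 4) ∞ v → (∀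 z : ℂ, z ≠ 0 → v z = u z⁻¹) → Literature.Geometry.Symplectic.IsJHolomorphic (𝓡 4) (fun y => J y) u → Literature.Geometry.Symplectic.IsJHolomorphic (𝓡 4) (fun y => J y) v → ∀ z : ℂ, u z = u 0 :=
  fun _ _ _ _ _ _ _ sf J u v hπ hs hc ht hu hv huv hJu hJv =>
    NoJSpheres.noJSpheres sf J u v hπ hs hc ht hu hv huv hJu hJv

end Summit.SmoothPoincare4.SmoothPoincare4.Theorems.GromovRecognitionRelEnd.CrossCapLaurent
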